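import Mathlib
import Literature.RepresentationTheory.FiniteGroups.InducedClassFunction
import Literature.RepresentationTheory.FiniteGroups.BrauerInduction
import Literature.RepresentationTheory.FiniteGroups.BrauerTheorem
import Literature.RepresentationTheory.FiniteGroups.MonomialRepresentation
import Literature.RepresentationTheory.FiniteGroups.GLnUnipotent
import Literature.RepresentationTheory.FiniteGroups.GLnBruhat
import Summits.MatrixMultiplication.MatrixMultiplication.Theorems.LieRankDesigns.Negative.Basics
import Summits.MatrixMultiplication.MatrixMultiplication.Theorems.SubgroupIdentityDesigns.Negative.GrassmannCharacter

/-!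
# `⟨Ind_P^G 1, Ind_P^G 1⟩ ≤ k + 1` for the `k`-subspace stabiliser `P ≤ GL_{k+l}(F)`

Supports stmt-MatrixMultiplication-14079 (route `LevelGradedCohnUmans`).  VALUE = theorem, NOT
    summit
progress.  This is the orbit-count input of the general-`k` block-slice no-go
(`GrassmannNoGo.no_translate_witness_of_norm`): with `Φ = grassChar F k l = Ind_P^G 1`,
`⟨Φ, Φ⟩ = #(P-orbits on G/P) ≤ k + 1` (`classInner_grassChar_le`).  Proof:

* Frobenius reciprocity + Burnside: `⟨Φ, Φ⟩ = |P|⁻¹ ∑_{s ∈ P} #Fix(s) = #orbits`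
  (`classInner_grassChar_eq_card_orbits`);
* Bruhat (`GLn.exists_bruhat`: `g = u₁⁻¹ (w · diag) u₂⁻¹`, `uᵢ` unitriangular `∈ P`): every coset
  `gP` is `P`-equivalent to a permutation coset `wP` (`exists_perm_orbit`);
* two permutations `σ, σ'` with the same `j = #{a < k : σ a < k}` satisfy `σ' = α σ β` with `α, β`
  BLOCK-PRESERVING (`∈ S_k × S_l ⊂ P`) — `exists_blockPerm`, by matching the four fibres of
  `x ↦ ([x < k], [σ x < k])` (`Equiv.ofFiberEquiv`); hence `wP ∼ w'P` and the orbit of `gP` is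
  determined by an invariant in `{0, …, k}` (`card_orbits_le`).
-/

set_option linter.dupNamespace false

noncomputable section

open scoped BigOperators Matrix Classical
open Literature.RepresentationTheory.FiniteGroups
open Literature.RepresentationTheory.FiniteGroups.GLn (unitUpper exists_bruhat)

namespace Summit.MatrixMultiplication.MatrixMultiplication.Theorems.SubgroupIdentityDesigns.Negative
namespace GrassmannOrbits

open GrassmannCharacter (subspaceStab mem_subspaceStab_iff castAdd_ne_natAdd grassChar
    grassChar_apply)

variable {F : Type} [Field F] [Fintype F] [DecidableEq F] {k l : ℕ}


/-! ## Permutation matrices -/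

omit [Fintype F] [DecidableEq F] in
/-- `w(σ)⁻¹ w(σ) = 1` for the `PEquiv` matrices. -/
theorem toMatrix_inv_mul (σ : (Equiv.Perm (Fin (k + l)))) :
    ((σ⁻¹).toPEquiv.toMatrix : (Matrix (Fin (k + l)) (Fin (k + l)) F)) * σ.toPEquiv.toMatrix = 1 :=
        by
  rw [← PEquiv.toMatrix_trans, ← Equiv.toPEquiv_trans, Equiv.Perm.inv_def, Equiv.symm_trans_self,
    Equiv.toPEquiv_refl, PEquiv.toMatrix_refl]

/-- The permutation matrix `w(σ) ∈ GL_{k+l}(F)`, `w(σ)_{ij} = [i = σ j]` (`w(σ) e_j = e_{σ j}`). -/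
def permGL (σ : (Equiv.Perm (Fin (k + l)))) : GL (Fin (k + l)) F where
  val := (σ⁻¹).toPEquiv.toMatrix
  inv := σ.toPEquiv.toMatrix
  val_inv := toMatrix_inv_mul σ
  inv_val := by simpa only [inv_inv] using toMatrix_inv_mul (F := F) σ⁻¹

omit [Fintype F] [DecidableEq F] in
/-- Entries of `w(σ)`. -/
theorem permGL_apply (σ : (Equiv.Perm (Fin (k + l)))) (i j : Fin (k + l)) :
    ((permGL σ : (GL (Fin (k + l)) F)) : (Matrix (Fin (k + l)) (Fin (k + l)) F)) i j = if i = σ j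
        then 1 else 0 := by
  show ((σ⁻¹).toPEquiv.toMatrix : (Matrix (Fin (k + l)) (Fin (k + l)) F)) i j = _
  simp only [PEquiv.toMatrix_apply, Equiv.toPEquiv_apply, Option.mem_def, Option.some.injEq,
    Equiv.Perm.inv_def, Equiv.symm_apply_eq]

omit [Fintype F] [DecidableEq F] in
/-- `σ ↦ w(σ)` is multiplicative. -/
theorem permGL_mul (α β : (Equiv.Perm (Fin (k + l)))) : (permGL (α * β) : (GL (Fin (k + l)) F)) =
    permGL α * permGL β := by
  refine Units.ext ?_
  show (((α * β)⁻¹).toPEquiv.toMatrix : (Matrix (Fin (k + l)) (Fin (k + l)) F)) =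
      (α⁻¹).toPEquiv.toMatrix * (β⁻¹).toPEquiv.toMatrix
  rw [mul_inv_rev, Equiv.Perm.mul_def, Equiv.toPEquiv_trans, PEquiv.toMatrix_trans]

omit [Fintype F] [DecidableEq F] in
/-- `w(1) = 1`. -/
theorem permGL_one : (permGL (1 : (Equiv.Perm (Fin (k + l)))) : (GL (Fin (k + l)) F)) = 1 := by
  refine Units.ext ?_
  show (((1 : (Equiv.Perm (Fin (k + l))))⁻¹).toPEquiv.toMatrix : (Matrix (Fin (k + l)) (Fin (k +
      l)) F)) = 1
  rw [inv_one, Equiv.Perm.one_def, Equiv.toPEquiv_refl, PEquiv.toMatrix_refl]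

omit [Fintype F] [DecidableEq F] in
/-- `w(σ)⁻¹ = w(σ⁻¹)`. -/
theorem permGL_inv (σ : (Equiv.Perm (Fin (k + l)))) : (permGL σ : (GL (Fin (k + l)) F))⁻¹ = permGL
    σ⁻¹ :=
  inv_eq_of_mul_eq_one_right (by rw [← permGL_mul, mul_inv_cancel, permGL_one])

omit [Fintype F] [DecidableEq F] in
/-- `(w(σ) N)_{ij} = N_{σ⁻¹ i, j}`. -/
theorem permGL_mul_apply (σ : (Equiv.Perm (Fin (k + l)))) (N : (Matrix (Fin (k + l)) (Fin (k + l))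
    F)) (i j : Fin (k + l)) :
    (((permGL σ : (GL (Fin (k + l)) F)) : (Matrix (Fin (k + l)) (Fin (k + l)) F)) * N) i j = N (σ⁻¹
        i) j := by
  rw [Matrix.mul_apply, Finset.sum_eq_single (σ⁻¹ i)]
  · have hi : i = σ (σ⁻¹ i) := (σ.apply_symm_apply i).symm
    rw [permGL_apply, if_pos hi, one_mul]
  · intro x _ hx
    rw [permGL_apply, if_neg, zero_mul]
    intro h
    exact hx (by rw [h]; exact (σ.symm_apply_apply x).symm)
  · intro h
    exact absurd (Finset.mem_univ _) h

omit [Fintype F] [DecidableEq F] in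
/-- A block-preserving permutation matrix lies in `P`. -/
theorem permGL_mem {α : (Equiv.Perm (Fin (k + l)))} (hα : ∀ x, ((α x : Fin (k + l)) : ℕ) < k ↔ (x :
    ℕ) < k) :
    (permGL α : (GL (Fin (k + l)) F)) ∈ (subspaceStab F k l) := by
  rw [mem_subspaceStab_iff]
  intro i j
  rw [permGL_apply, if_neg]
  intro h
  have h1 : ((α (Fin.castAdd l j) : Fin (k + l)) : ℕ) < k := (hα _).mpr (by simp)
  rw [← h] at h1
  simp at h1

omit [Fintype F] [DecidableEq F] in
/-- Upper unitriangular matrices lie in `P`. -/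
theorem unitUpper_le : unitUpper F (k + l) ≤ (subspaceStab F k l) := by
  intro g hg
  rw [mem_subspaceStab_iff]
  intro i j
  have hj := j.isLt
  exact hg.1 _ _ (by rw [Fin.lt_def, Fin.val_castAdd, Fin.val_natAdd]; omega)

omit [Fintype F] [DecidableEq F] in
/-- **Bruhat**: every coset `gP` is `P`-equivalent to a permutation coset `w(τ)P`. -/
theorem exists_perm_orbit (x : (GL (Fin (k + l)) F)) : ∃ τ : (Equiv.Perm (Fin (k + l))), ∃ s :
    (subspaceStab F k l), s • ((permGL τ : (GL (Fin (k + l)) F)) : (GL (Fin (k + l)) F ⧸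
    subspaceStab F k l)) = (x : (GL (Fin (k + l)) F ⧸ subspaceStab F k l)) := by
  obtain ⟨u₁, hu₁, u₂, hu₂, σ, d, hm⟩ := exists_bruhat x
  have ht : (permGL σ : (GL (Fin (k + l)) F))⁻¹ * (u₁ * x * u₂) ∈ (subspaceStab F k l) := by
    rw [permGL_inv, mem_subspaceStab_iff]
    intro i j
    rw [Units.val_mul, permGL_mul_apply, inv_inv, hm, if_neg]
    intro h
    exact castAdd_ne_natAdd j i (σ.injective h.symm)
  refine ⟨σ, ⟨u₁⁻¹, inv_mem (unitUpper_le hu₁)⟩, ?_⟩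
  show ((((u₁⁻¹ : (GL (Fin (k + l)) F)) * permGL σ : (GL (Fin (k + l)) F))) : (GL (Fin (k + l)) F ⧸
      subspaceStab F k l)) = (x : (GL (Fin (k + l)) F ⧸ subspaceStab F k l))
  refine QuotientGroup.eq.mpr ?_
  have h : ((u₁⁻¹ : (GL (Fin (k + l)) F)) * permGL σ)⁻¹ * x = (permGL σ : (GL (Fin (k + l)) F))⁻¹ *
      (u₁ * x * u₂) * u₂⁻¹ := by group
  show ((u₁⁻¹ : (GL (Fin (k + l)) F)) * permGL σ)⁻¹ * x ∈ (subspaceStab F k l)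
  rw [h]
  exact mul_mem ht (inv_mem (unitUpper_le hu₂))

/-! ## The invariant `j(σ) = #{x < k : σ x < k}` -/

/-- The pattern `x ↦ ([x < k], [σ x < k])`. -/
def pat (σ : (Equiv.Perm (Fin (k + l)))) (x : Fin (k + l)) : Bool × Bool :=
  (decide ((x : ℕ) < k), decide (((σ x : Fin (k + l)) : ℕ) < k))

/-- Fibre sizes of the pattern. -/
def cnt (σ : (Equiv.Perm (Fin (k + l)))) (c : Bool × Bool) : ℕ :=
  (Finset.univ.filter fun x : Fin (k + l) => pat σ x = c).card

omit [Fintype F] [DecidableEq F] in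
/-- `#{x : x < k} = k` in `Fin (k + l)`. -/
theorem card_filter_lt : (Finset.univ.filter fun x : Fin (k + l) => (x : ℕ) < k).card = k := by
  have h : (Finset.univ.filter fun x : Fin (k + l) => (x : ℕ) < k) =
      Finset.univ.map (Fin.castAddEmb l) := by
    ext x
    simp only [Finset.mem_filter, Finset.mem_univ, true_and, Finset.mem_map, Fin.castAddEmb_apply]
    constructor
    · intro hx
      exact ⟨⟨x, hx⟩, Fin.ext rfl⟩
    · rintro ⟨y, rfl⟩
      simp
  rw [h, Finset.card_map, Finset.card_univ, Fintype.card_fin]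

omit [Fintype F] [DecidableEq F] in
/-- `#{x : σ x < k} = k`. -/
theorem card_filter_perm_lt (σ : (Equiv.Perm (Fin (k + l)))) :
    (Finset.univ.filter fun x : Fin (k + l) => ((σ x : Fin (k + l)) : ℕ) < k).card = k := by
  have h : (Finset.univ.filter fun y : Fin (k + l) => (y : ℕ) < k) =
      (Finset.univ.filter fun x : Fin (k + l) => ((σ x : Fin (k + l)) : ℕ) < k).map
        σ.toEmbedding := by
    conv_lhs => rw [← Finset.map_univ_equiv σ, Finset.filter_map]
    rfl
  calc (Finset.univ.filter fun x : Fin (k + l) => ((σ x : Fin (k + l)) : ℕ) < k).card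
      = ((Finset.univ.filter fun x : Fin (k + l) => ((σ x : Fin (k + l)) : ℕ) < k).map
          σ.toEmbedding).card := (Finset.card_map _).symm
    _ = (Finset.univ.filter fun y : Fin (k + l) => (y : ℕ) < k).card := by rw [← h]
    _ = k := card_filter_lt

omit [Fintype F] [DecidableEq F] in
/-- Row sum: `cnt(t,t) + cnt(t,f) = k`. -/
theorem cnt_tt_add_tf (σ : (Equiv.Perm (Fin (k + l)))) : cnt σ (true, true) + cnt σ (true, false) =
    k := by
  have h := Finset.card_filter_add_card_filter_not
    (s := Finset.univ.filter fun x : Fin (k + l) => (x : ℕ) < k)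
    (fun x : Fin (k + l) => ((σ x : Fin (k + l)) : ℕ) < k)
  rw [Finset.filter_filter, Finset.filter_filter, card_filter_lt] at h
  have e1 : (Finset.univ.filter fun x : Fin (k + l) => pat σ x = (true, true)) =
      Finset.univ.filter fun x : Fin (k + l) =>
        (x : ℕ) < k ∧ ((σ x : Fin (k + l)) : ℕ) < k := by
    ext x; simp [pat]
  have e2 : (Finset.univ.filter fun x : Fin (k + l) => pat σ x = (true, false)) =
      Finset.univ.filter fun x : Fin (k + l) =>
        (x : ℕ) < k ∧ ¬ ((σ x : Fin (k + l)) : ℕ) < k := by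
    ext x; simp [pat]
  unfold cnt
  rw [e1, e2]
  exact h

omit [Fintype F] [DecidableEq F] in
/-- Column sum: `cnt(t,t) + cnt(f,t) = k`. -/
theorem cnt_tt_add_ft (σ : (Equiv.Perm (Fin (k + l)))) : cnt σ (true, true) + cnt σ (false, true) =
    k := by
  have h := Finset.card_filter_add_card_filter_not
    (s := Finset.univ.filter fun x : Fin (k + l) => ((σ x : Fin (k + l)) : ℕ) < k)
    (fun x : Fin (k + l) => (x : ℕ) < k)
  rw [Finset.filter_filter, Finset.filter_filter, card_filter_perm_lt] at h
  have e1 : (Finset.univ.filter fun x : Fin (k + l) => pat σ x = (true, true)) =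
      Finset.univ.filter fun x : Fin (k + l) =>
        ((σ x : Fin (k + l)) : ℕ) < k ∧ (x : ℕ) < k := by
    ext x; simp only [Finset.mem_filter, Finset.mem_univ, true_and, pat, Prod.mk.injEq,
      decide_eq_true_eq]; tauto
  have e2 : (Finset.univ.filter fun x : Fin (k + l) => pat σ x = (false, true)) =
      Finset.univ.filter fun x : Fin (k + l) =>
        ((σ x : Fin (k + l)) : ℕ) < k ∧ ¬ (x : ℕ) < k := by
    ext x; simp only [Finset.mem_filter, Finset.mem_univ, true_and, pat, Prod.mk.injEq,
      decide_eq_true_eq, decide_eq_false_iff_not]; tauto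
  unfold cnt
  rw [e1, e2]
  exact h

omit [Fintype F] [DecidableEq F] in
/-- Total: the four fibres partition `Fin (k + l)`. -/
theorem cnt_sum (σ : (Equiv.Perm (Fin (k + l)))) :
    cnt σ (true, true) + cnt σ (true, false) + cnt σ (false, true) + cnt σ (false, false) =
      k + l := by
  have h := Finset.card_eq_sum_card_fiberwise (s := (Finset.univ : Finset (Fin (k + l))))
    (t := (Finset.univ : Finset (Bool × Bool))) (f := pat σ) (fun _ _ => Finset.mem_univ _)
  rw [Finset.card_univ, Fintype.card_fin, Fintype.sum_prod_type] at h
  simp only [Fintype.sum_bool] at h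
  unfold cnt
  omega

omit [Fintype F] [DecidableEq F] in
/-- Equal `j`-invariant ⇒ all four fibre sizes agree. -/
theorem cnt_eq_of_tt {σ σ' : (Equiv.Perm (Fin (k + l)))} (h : cnt σ (true, true) = cnt σ' (true,
    true)) (c : Bool × Bool) :
    cnt σ c = cnt σ' c := by
  have h1 := cnt_tt_add_tf (k := k) (l := l) σ
  have h1' := cnt_tt_add_tf (k := k) (l := l) σ'
  have h2 := cnt_tt_add_ft (k := k) (l := l) σ
  have h2' := cnt_tt_add_ft (k := k) (l := l) σ'
  have h3 := cnt_sum (k := k) (l := l) σ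
  have h3' := cnt_sum (k := k) (l := l) σ'
  obtain ⟨a, b⟩ := c
  cases a <;> cases b <;> omega

omit [Fintype F] [DecidableEq F] in
/-- **Double cosets**: permutations with the same `j`-invariant differ by block-preserving
permutations on both sides. -/
theorem exists_blockPerm {σ σ' : (Equiv.Perm (Fin (k + l)))} (h : cnt σ (true, true) = cnt σ'
    (true, true)) :
    ∃ α β : (Equiv.Perm (Fin (k + l))), (∀ x, ((α x : Fin (k + l)) : ℕ) < k ↔ (x : ℕ) < k) ∧
      (∀ x, ((β x : Fin (k + l)) : ℕ) < k ↔ (x : ℕ) < k) ∧ σ' = α * σ * β := by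
  have hc : ∀ c : Bool × Bool,
      Fintype.card {x : Fin (k + l) // pat σ' x = c} =
        Fintype.card {x : Fin (k + l) // pat σ x = c} :=
    fun c => by simp only [Fintype.card_subtype]; exact (cnt_eq_of_tt h c).symm
  let β : (Equiv.Perm (Fin (k + l))) := Equiv.ofFiberEquiv (f := pat σ') (g := pat σ) fun c =>
      Fintype.equivOfCardEq (hc c)
  have hβ : ∀ x, pat σ (β x) = pat σ' x := fun x => Equiv.ofFiberEquiv_map _ x
  have hβ1 : ∀ x, ((β x : Fin (k + l)) : ℕ) < k ↔ (x : ℕ) < k := fun x => by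
    have := congrArg Prod.fst (hβ x)
    simpa only [pat, decide_eq_decide] using this
  have hβ2 : ∀ x, (((σ (β x)) : Fin (k + l)) : ℕ) < k ↔ ((σ' x : Fin (k + l)) : ℕ) < k := fun x =>
      by
    have := congrArg Prod.snd (hβ x)
    simpa only [pat, decide_eq_decide] using this
  refine ⟨σ' * β⁻¹ * σ⁻¹, β, fun y => ?_, hβ1, by group⟩
  have h2 := hβ2 (β⁻¹ (σ⁻¹ y))
  rw [show β (β⁻¹ (σ⁻¹ y)) = σ⁻¹ y from β.apply_symm_apply _,
    show σ (σ⁻¹ y) = y from σ.apply_symm_apply _] at h2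
  simp only [Equiv.Perm.mul_apply]
  exact h2.symm

omit [Fintype F] [DecidableEq F] in
/-- `j(σ) ≤ k`. -/
theorem cnt_tt_le (σ : (Equiv.Perm (Fin (k + l)))) : cnt σ (true, true) ≤ k := by
  have := cnt_tt_add_tf (k := k) (l := l) σ
  omega

/-! ## Orbit count -/

omit [Fintype F] [DecidableEq F] in
/-- Equal `j`-invariant ⇒ the permutation cosets lie in one `P`-orbit. -/
theorem perm_mem_orbit {σ σ' : (Equiv.Perm (Fin (k + l)))} (h : cnt σ (true, true) = cnt σ' (true,
    true)) :
    ((permGL σ' : (GL (Fin (k + l)) F)) : (GL (Fin (k + l)) F ⧸ subspaceStab F k l)) ∈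
        MulAction.orbit (subspaceStab F k l) ((permGL σ : (GL (Fin (k + l)) F)) : (GL (Fin (k + l))
        F ⧸ subspaceStab F k l)) := by
  obtain ⟨α, β, hα, hβ, rfl⟩ := exists_blockPerm (k := k) (l := l) h
  refine MulAction.mem_orbit_iff.mpr ⟨⟨permGL α, permGL_mem hα⟩, ?_⟩
  show ((((permGL α : (GL (Fin (k + l)) F)) * permGL σ : (GL (Fin (k + l)) F))) : (GL (Fin (k + l))
      F ⧸ subspaceStab F k l)) = ((permGL (α * σ * β) : (GL (Fin (k + l)) F)) : (GL (Fin (k + l)) F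
      ⧸ subspaceStab F k l))
  rw [permGL_mul, permGL_mul, QuotientGroup.mk_mul_of_mem _ (permGL_mem hβ)]

/-- **`#(P-orbits on G/P) ≤ k + 1`.** -/
theorem card_orbits_le :
    Fintype.card (Quotient (MulAction.orbitRel (subspaceStab F k l) (GL (Fin (k + l)) F ⧸
        subspaceStab F k l))) ≤ k + 1 := by
  -- a permutation representative for every orbit
  have hrep : ∀ o : Quotient (MulAction.orbitRel (subspaceStab F k l) (GL (Fin (k + l)) F ⧸
      subspaceStab F k l)), ∃ τ : (Equiv.Perm (Fin (k + l))),
      o = Quotient.mk _ ((permGL τ : (GL (Fin (k + l)) F)) : (GL (Fin (k + l)) F ⧸ subspaceStab F k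
          l)) := by
    intro o
    induction o using Quotient.inductionOn with
    | h q =>
      obtain ⟨τ, s, hs⟩ := exists_perm_orbit (F := F) (k := k) (l := l) q.out
      rw [QuotientGroup.out_eq'] at hs
      exact ⟨τ, Quotient.sound (MulAction.orbitRel_apply.mpr
        (MulAction.mem_orbit_iff.mpr ⟨s, hs⟩))⟩
  choose τ hτ using hrep
  let J : Quotient (MulAction.orbitRel (subspaceStab F k l) (GL (Fin (k + l)) F ⧸ subspaceStab F k
      l)) → Fin (k + 1) := fun o =>
    ⟨cnt (τ o) (true, true), Nat.lt_succ_of_le (cnt_tt_le _)⟩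
  have hJ : Function.Injective J := by
    intro o o' h
    have h' : cnt (τ o) (true, true) = cnt (τ o') (true, true) := congrArg Fin.val h
    rw [hτ o, hτ o']
    exact (Quotient.sound (MulAction.orbitRel_apply.mpr (perm_mem_orbit h'))).symm
  have := Fintype.card_le_of_injective J hJ
  rwa [Fintype.card_fin] at this

/-! ## The norm of `Φ` -/

/-- `Φ(s⁻¹) = #Fix(s)` on `G/P`. -/
theorem grassChar_inv_apply (s : (subspaceStab F k l)) :
    grassChar F k l ((s⁻¹ : (subspaceStab F k l)) : (GL (Fin (k + l)) F)) = ((Finset.univ.filter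
        fun q : (GL (Fin (k + l)) F ⧸ subspaceStab F k l) => s • q = q).card : ℂ) := by
  rw [grassChar_apply, Finset.natCast_card_filter]
  refine Finset.sum_congr rfl fun q _ => ?_
  congr 1
  simp only [Subgroup.coe_inv, eq_iff_iff]
  rw [inv_smul_eq_iff]
  exact ⟨fun h => h.symm, fun h => h.symm⟩

/-- **Frobenius + Burnside**: `⟨Φ, Φ⟩ = #(P-orbits on G/P)`. -/
theorem classInner_grassChar_eq_card_orbits :
    classInner (grassChar F k l) (grassChar F k l) =
      (Fintype.card (Quotient (MulAction.orbitRel (subspaceStab F k l) (GL (Fin (k + l)) F ⧸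
          subspaceStab F k l))) : ℂ) := by
  unfold grassChar
  rw [classInner_indClassFun_left _ _ (isClassFun_indClassFun _ _), classInner_apply]
  have hterm : ∀ s : (subspaceStab F k l), (fun _ : (subspaceStab F k l) => (1 : ℂ)) s *
      (fun x : (subspaceStab F k l) => indClassFun (subspaceStab F k l) (fun _ => (1 : ℂ)) x) s⁻¹ =
        ((Finset.univ.filter fun q : (GL (Fin (k + l)) F ⧸ subspaceStab F k l) => s • q = q).card :
            ℂ) := by
    intro s
    rw [one_mul]
    exact grassChar_inv_apply s
  rw [Finset.sum_congr rfl fun s _ => hterm s, ← Nat.cast_sum]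
  have hfix : ∀ s : (subspaceStab F k l), Fintype.card (MulAction.fixedBy (GL (Fin (k + l)) F ⧸
      subspaceStab F k l) s) =
      (Finset.univ.filter fun q : (GL (Fin (k + l)) F ⧸ subspaceStab F k l) => s • q = q).card := by
    intro s
    rw [← Set.toFinset_card]
    congr 1
    ext q
    simp [MulAction.mem_fixedBy]
  rw [← Finset.sum_congr rfl fun s _ => hfix s,
    MulAction.sum_card_fixedBy_eq_card_orbits_mul_card_group (subspaceStab F k l) (GL (Fin (k + l))
        F ⧸ subspaceStab F k l), Nat.cast_mul]
  have hc : (Fintype.card (subspaceStab F k l) : ℂ) ≠ 0 := Nat.cast_ne_zero.mpr Fintype.card_ne_zero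
  rw [mul_comm ((Fintype.card (Quotient (MulAction.orbitRel (subspaceStab F k l) (GL (Fin (k + l))
      F ⧸ subspaceStab F k l))) : ℂ)), ← mul_assoc,
    inv_mul_cancel₀ hc, one_mul]

/-- **`⟨Φ, Φ⟩ ≤ k + 1`.** -/
theorem classInner_grassChar_le :
    (classInner (grassChar F k l) (grassChar F k l)).re ≤ ((k + 1 : ℕ) : ℝ) := by
  rw [classInner_grassChar_eq_card_orbits, Complex.natCast_re]
  exact_mod_cast card_orbits_le (F := F) (k := k) (l := l)

end GrassmannOrbits
end Summit.MatrixMultiplication.MatrixMultiplication.Theorems.SubgroupIdentityDesigns.Negative
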